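import Summits.Parity.GeneralizedHardyLittlewood.Theorems.GreenTaoLevelTwoMNTwoTypeIIFirstCS
import Mathlib.Algebra.Order.Chebyshev

/-!
# Route `GreenTaoLevelTwo`, crux `MNTwo` (stmt-Parity-21276), line `birth`, stub `stub_mnVertical`:
# the second Cauchy–Schwarz of Lemma 24 and the pigeonholing of `(l₀,m₀)` (GT 2008b §10)

Block V4 / H3 (= AIF §10 Lemma 24 "Type II sum implies major arc", the step "Applying Lemma (cz)
again, this time in the `l₀` and `m₀` variables … `≳ L³M³`.  Writing `l₀' = l₀ + l₂`,
`m₀' = m₀ + m₂` … By the pigeonhole principle, we can find `l₀` and `m₀` such that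
`|∑_{l₁,l₂,m₁,m₂} ∏ C^{i₁+i₂+j₁+j₂} f(l₀+i₁l₁+i₂l₂, m₀+j₁m₁+j₂m₂)| ≳ L²M²`") of the
`stub_mnVertical` census (B. Green, T. Tao, *Quadratic uniformity of the Möbius function*, Ann.
Inst. Fourier 58 (2008) = arXiv:math/0606087, §10).  Def-free, explicit; the input is the output
shape of `…MNTwoTypeIIFirstCS.first_cs_differences`, the sixteenfold product is written in the
nesting "(CS in `(l₁,m₁)`) then (CS in `(l₂,m₂)`)".

* `sum_comm₆` — moving the two innermost of six sums outermost;
* `second_cs_pigeonhole` — the step quoted above: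
  `∃ l₀ ∈ [1,L], m₀ ∈ [1,M]` with `Y⁴/((2L+1)³(2M+1)³L³M³) ≤ Re ∑_{l₁,m₁,l₂,m₂} ∏₁₆`.

References: [GreenTao2008QuadraticMobius] arXiv:math/0606087 §10 (proof of Lemma 24), App. A
Lemma 38.
-/

open Finset
open scoped ComplexConjugate

namespace Summit.Parity.GeneralizedHardyLittlewood.GreenTaoLevelTwoMNTwoTypeIISecondCS

open Summit.Parity.GeneralizedHardyLittlewood.GreenTaoLevelTwoMNTwoTypeIIFirstCS
  (first_cs_differences)

variable {α β γ δ ε ζ : Type*}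

/-- `∑_a ∑_b ∑_c ∑_d ∑_x ∑_y F = ∑_x ∑_y ∑_a ∑_b ∑_c ∑_d F`. [folklore] -/
theorem sum_comm₆ (sa : Finset α) (sb : Finset β) (sc : Finset γ) (sd : Finset δ) (sx : Finset ε)
    (sy : Finset ζ) (F : α → β → γ → δ → ε → ζ → ℂ) :
    ∑ a ∈ sa, ∑ b ∈ sb, ∑ c ∈ sc, ∑ d ∈ sd, ∑ x ∈ sx, ∑ y ∈ sy, F a b c d x y =
      ∑ x ∈ sx, ∑ y ∈ sy, ∑ a ∈ sa, ∑ b ∈ sb, ∑ c ∈ sc, ∑ d ∈ sd, F a b c d x y := by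
  calc ∑ a ∈ sa, ∑ b ∈ sb, ∑ c ∈ sc, ∑ d ∈ sd, ∑ x ∈ sx, ∑ y ∈ sy, F a b c d x y
      = ∑ a ∈ sa, ∑ b ∈ sb, ∑ c ∈ sc, ∑ x ∈ sx, ∑ d ∈ sd, ∑ y ∈ sy, F a b c d x y :=
        Finset.sum_congr rfl fun _ _ => Finset.sum_congr rfl fun _ _ =>
          Finset.sum_congr rfl fun _ _ => Finset.sum_comm
    _ = ∑ a ∈ sa, ∑ b ∈ sb, ∑ x ∈ sx, ∑ c ∈ sc, ∑ d ∈ sd, ∑ y ∈ sy, F a b c d x y :=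
        Finset.sum_congr rfl fun _ _ => Finset.sum_congr rfl fun _ _ => Finset.sum_comm
    _ = ∑ a ∈ sa, ∑ x ∈ sx, ∑ b ∈ sb, ∑ c ∈ sc, ∑ d ∈ sd, ∑ y ∈ sy, F a b c d x y :=
        Finset.sum_congr rfl fun _ _ => Finset.sum_comm
    _ = ∑ x ∈ sx, ∑ a ∈ sa, ∑ b ∈ sb, ∑ c ∈ sc, ∑ d ∈ sd, ∑ y ∈ sy, F a b c d x y :=
        Finset.sum_comm
    _ = ∑ x ∈ sx, ∑ a ∈ sa, ∑ b ∈ sb, ∑ c ∈ sc, ∑ y ∈ sy, ∑ d ∈ sd, F a b c d x y :=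
        Finset.sum_congr rfl fun _ _ => Finset.sum_congr rfl fun _ _ =>
          Finset.sum_congr rfl fun _ _ => Finset.sum_congr rfl fun _ _ => Finset.sum_comm
    _ = ∑ x ∈ sx, ∑ a ∈ sa, ∑ b ∈ sb, ∑ y ∈ sy, ∑ c ∈ sc, ∑ d ∈ sd, F a b c d x y :=
        Finset.sum_congr rfl fun _ _ => Finset.sum_congr rfl fun _ _ =>
          Finset.sum_congr rfl fun _ _ => Finset.sum_comm
    _ = ∑ x ∈ sx, ∑ a ∈ sa, ∑ y ∈ sy, ∑ b ∈ sb, ∑ c ∈ sc, ∑ d ∈ sd, F a b c d x y :=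
        Finset.sum_congr rfl fun _ _ => Finset.sum_congr rfl fun _ _ => Finset.sum_comm
    _ = ∑ x ∈ sx, ∑ y ∈ sy, ∑ a ∈ sa, ∑ b ∈ sb, ∑ c ∈ sc, ∑ d ∈ sd, F a b c d x y :=
        Finset.sum_congr rfl fun _ _ => Finset.sum_comm

/-- **The second Cauchy–Schwarz and the pigeonholing of `(l₀,m₀)` (GT 2008b §10, Lemma 24).**
For `f : ℤ → ℤ → ℂ` vanishing outside `[1,L] × [1,M]` (`L, M ≥ 1`) write
`F(l₁,m₁;l,m) = f(l,m) conj f(l,m+m₁) conj f(l+l₁,m) f(l+l₁,m+m₁)`.  If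
`Y ≤ ∑_{l₁∈[−L,L]} ∑_{m₁∈[−M,M]} ‖∑_{l∈[1,L]} ∑_{m∈[1,M]} F(l₁,m₁;l,m)‖` with `Y ≥ 0`, then there
are `l₀ ∈ [1,L]`, `m₀ ∈ [1,M]` with
`Y⁴/((2L+1)³(2M+1)³L³M³) ≤ Re ∑_{l₁,m₁,l₂,m₂} F(l₀,m₀)conj F(l₀,m₀+m₂)conj F(l₀+l₂,m₀)F(l₀+l₂,m₀+m₂)`
(arguments `(l₁,m₁;·,·)` suppressed).
[cite: GreenTao2008QuadraticMobius, §10 (proof of Lemma 24)] -/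
theorem second_cs_pigeonhole {L M : ℕ} (hL : 1 ≤ L) (hM : 1 ≤ M) (f : ℤ → ℤ → ℂ)
    (hf : ∀ l m, (l ∉ Icc (1 : ℤ) L ∨ m ∉ Icc (1 : ℤ) M) → f l m = 0) {Y : ℝ} (hY : 0 ≤ Y)
    (h : Y ≤ ∑ l₁ ∈ Icc (-(L : ℤ)) L, ∑ m₁ ∈ Icc (-(M : ℤ)) M,
      ‖∑ l ∈ Icc (1 : ℤ) L, ∑ m ∈ Icc (1 : ℤ) M,
        f l m * conj (f l (m + m₁)) * conj (f (l + l₁) m) * f (l + l₁) (m + m₁)‖) :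
    ∃ l₀ ∈ Icc (1 : ℤ) L, ∃ m₀ ∈ Icc (1 : ℤ) M,
      Y ^ 4 / (((2 * L + 1 : ℕ) : ℝ) ^ 3 * ((2 * M + 1 : ℕ) : ℝ) ^ 3 * (L : ℝ) ^ 3 * (M : ℝ) ^ 3) ≤
      (∑ l₁ ∈ Icc (-(L : ℤ)) L, ∑ m₁ ∈ Icc (-(M : ℤ)) M, ∑ l₂ ∈ Icc (-(L : ℤ)) L,
        ∑ m₂ ∈ Icc (-(M : ℤ)) M,
        (f l₀ m₀ * conj (f l₀ (m₀ + m₁)) * conj (f (l₀ + l₁) m₀) * f (l₀ + l₁) (m₀ + m₁)) *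
        conj (f l₀ (m₀ + m₂) * conj (f l₀ (m₀ + m₂ + m₁)) * conj (f (l₀ + l₁) (m₀ + m₂)) *
          f (l₀ + l₁) (m₀ + m₂ + m₁)) *
        conj (f (l₀ + l₂) m₀ * conj (f (l₀ + l₂) (m₀ + m₁)) * conj (f (l₀ + l₂ + l₁) m₀) *
          f (l₀ + l₂ + l₁) (m₀ + m₁)) *
        (f (l₀ + l₂) (m₀ + m₂) * conj (f (l₀ + l₂) (m₀ + m₂ + m₁)) *
          conj (f (l₀ + l₂ + l₁) (m₀ + m₂)) * f (l₀ + l₂ + l₁) (m₀ + m₂ + m₁))).re := by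
  classical
  -- the doubled function `F(l₁,m₁; l, m)` as an opaque function
  obtain ⟨F, hF⟩ : ∃ F : ℤ → ℤ → ℤ → ℤ → ℂ, F = fun l₁ m₁ l m =>
    f l m * conj (f l (m + m₁)) * conj (f (l + l₁) m) * f (l + l₁) (m + m₁) := ⟨_, rfl⟩
  have hF0 : ∀ l₁ m₁ l m, (l ∉ Icc (1 : ℤ) L ∨ m ∉ Icc (1 : ℤ) M) → F l₁ m₁ l m = 0 := by
    intro l₁ m₁ l m hlm
    rw [hF]; simp only [hf l m hlm, zero_mul]
  have hLr : (0 : ℝ) < L := by exact_mod_cast hL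
  have hMr : (0 : ℝ) < M := by exact_mod_cast hM
  -- Step 1: for each `(l₁,m₁)`, the first-CS lemma applied to `F(l₁,m₁;·,·)` with `b = b' = 1`
  have hcs : ∀ l₁ m₁, ‖∑ l ∈ Icc (1 : ℤ) L, ∑ m ∈ Icc (1 : ℤ) M, F l₁ m₁ l m‖ ^ 4 ≤
      (L : ℝ) ^ 2 * (M : ℝ) ^ 2 *
        (∑ l₂ ∈ Icc (-(L : ℤ)) L, ∑ m₂ ∈ Icc (-(M : ℤ)) M, ∑ l ∈ Icc (1 : ℤ) L,
          ∑ m ∈ Icc (1 : ℤ) M, F l₁ m₁ l m * conj (F l₁ m₁ l (m + m₂)) *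
            conj (F l₁ m₁ (l + l₂) m) * F l₁ m₁ (l + l₂) (m + m₂)).re := by
    intro l₁ m₁
    have := first_cs_differences (L := L) (M := M) (F l₁ m₁) (hF0 l₁ m₁) (fun _ => 1)
      (fun _ => 1) (fun _ => by simp) (fun _ => by simp)
    simpa only [one_mul] using this
  -- Step 2: Hölder (power mean) over the `(2L+1)(2M+1)` pairs `(l₁,m₁)`
  set K := Icc (-(L : ℤ)) L ×ˢ Icc (-(M : ℤ)) M with hK
  have hcardK : (#K : ℝ) = ((2 * L + 1 : ℕ) : ℝ) * ((2 * M + 1 : ℕ) : ℝ) := by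
    rw [hK, Finset.card_product, Int.card_Icc, Int.card_Icc]
    have e1 : ((L : ℤ) + 1 - -(L : ℤ)).toNat = 2 * L + 1 := by omega
    have e2 : ((M : ℤ) + 1 - -(M : ℤ)).toNat = 2 * M + 1 := by omega
    rw [e1, e2]; push_cast; ring
  have h' : Y ≤ ∑ p ∈ K, ‖∑ l ∈ Icc (1 : ℤ) L, ∑ m ∈ Icc (1 : ℤ) M, F p.1 p.2 l m‖ := by
    rw [hK, Finset.sum_product]
    refine h.trans (le_of_eq ?_)
    refine Finset.sum_congr rfl fun l₁ _ => Finset.sum_congr rfl fun m₁ _ => ?_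
    rw [hF]
  have hpm := pow_sum_div_card_le_sum_pow (s := K)
    (f := fun p => ‖∑ l ∈ Icc (1 : ℤ) L, ∑ m ∈ Icc (1 : ℤ) M, F p.1 p.2 l m‖)
    (fun _ _ => norm_nonneg _) 3
  have hKpos : (0 : ℝ) < #K := by rw [hcardK]; positivity
  have hY4 : Y ^ 4 / (#K : ℝ) ^ 3 ≤
      ∑ p ∈ K, ‖∑ l ∈ Icc (1 : ℤ) L, ∑ m ∈ Icc (1 : ℤ) M, F p.1 p.2 l m‖ ^ 4 := by
    refine le_trans ?_ hpm
    exact div_le_div_of_nonneg_right (pow_le_pow_left₀ hY h' 4) (by positivity)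
  -- Step 3: combine: `Y⁴/#K³ ≤ L²M² Re ∑_{l₁,m₁} ∑_{l₂,m₂} ∑_{l,m} G`
  have hsum : Y ^ 4 / (#K : ℝ) ^ 3 ≤ (L : ℝ) ^ 2 * (M : ℝ) ^ 2 *
      (∑ l₁ ∈ Icc (-(L : ℤ)) L, ∑ m₁ ∈ Icc (-(M : ℤ)) M, ∑ l₂ ∈ Icc (-(L : ℤ)) L,
        ∑ m₂ ∈ Icc (-(M : ℤ)) M, ∑ l ∈ Icc (1 : ℤ) L, ∑ m ∈ Icc (1 : ℤ) M,
          F l₁ m₁ l m * conj (F l₁ m₁ l (m + m₂)) * conj (F l₁ m₁ (l + l₂) m) *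
            F l₁ m₁ (l + l₂) (m + m₂)).re := by
    refine hY4.trans ?_
    rw [hK, Finset.sum_product, Complex.re_sum, Finset.mul_sum]
    refine Finset.sum_le_sum fun l₁ _ => ?_
    rw [Complex.re_sum, Finset.mul_sum]
    exact Finset.sum_le_sum fun m₁ _ => hcs l₁ m₁
  -- Step 4: reorder and pigeonhole `(l, m) = (l₀, m₀)`
  rw [sum_comm₆] at hsum
  set P := Icc (1 : ℤ) L ×ˢ Icc (1 : ℤ) M with hP
  have hcardP : (#P : ℝ) = (L : ℝ) * M := by
    rw [hP, Finset.card_product, Int.card_Icc, Int.card_Icc]; push_cast; simp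
  set g : ℤ × ℤ → ℝ := fun q => (∑ l₁ ∈ Icc (-(L : ℤ)) L, ∑ m₁ ∈ Icc (-(M : ℤ)) M,
    ∑ l₂ ∈ Icc (-(L : ℤ)) L, ∑ m₂ ∈ Icc (-(M : ℤ)) M,
      F l₁ m₁ q.1 q.2 * conj (F l₁ m₁ q.1 (q.2 + m₂)) * conj (F l₁ m₁ (q.1 + l₂) q.2) *
        F l₁ m₁ (q.1 + l₂) (q.2 + m₂)).re with hg
  have hPg : ∑ q ∈ P, g q = (∑ l ∈ Icc (1 : ℤ) L, ∑ m ∈ Icc (1 : ℤ) M,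
      ∑ l₁ ∈ Icc (-(L : ℤ)) L, ∑ m₁ ∈ Icc (-(M : ℤ)) M, ∑ l₂ ∈ Icc (-(L : ℤ)) L,
        ∑ m₂ ∈ Icc (-(M : ℤ)) M,
          F l₁ m₁ l m * conj (F l₁ m₁ l (m + m₂)) * conj (F l₁ m₁ (l + l₂) m) *
            F l₁ m₁ (l + l₂) (m + m₂)).re := by
    rw [hP, Finset.sum_product (s := Icc (1 : ℤ) L) (t := Icc (1 : ℤ) M) (f := g),
      Complex.re_sum]
    refine Finset.sum_congr rfl fun l _ => ?_
    rw [Complex.re_sum]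
  have hsum' : Y ^ 4 / (#K : ℝ) ^ 3 / ((L : ℝ) ^ 2 * (M : ℝ) ^ 2) ≤ ∑ q ∈ P, g q := by
    rw [hPg, div_le_iff₀ (by positivity)]
    linarith [hsum]
  have hL' : (1 : ℤ) ≤ L := by exact_mod_cast hL
  have hM' : (1 : ℤ) ≤ M := by exact_mod_cast hM
  have hPne : P.Nonempty := by
    refine ⟨((1 : ℤ), (1 : ℤ)), ?_⟩
    rw [hP, Finset.mem_product, Finset.mem_Icc, Finset.mem_Icc]
    exact ⟨⟨le_rfl, hL'⟩, ⟨le_rfl, hM'⟩⟩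
  have hPpos : (0 : ℝ) < #P := by exact_mod_cast hPne.card_pos
  have hconst : ∑ _q ∈ P, Y ^ 4 / (#K : ℝ) ^ 3 / ((L : ℝ) ^ 2 * (M : ℝ) ^ 2) / #P ≤
      ∑ q ∈ P, g q := by
    rw [Finset.sum_const, nsmul_eq_mul, mul_div_cancel₀ _ hPpos.ne']
    exact hsum'
  obtain ⟨q, hq, hgq⟩ := Finset.exists_le_of_sum_le hPne hconst
  rw [hP, Finset.mem_product] at hq
  refine ⟨q.1, hq.1, q.2, hq.2, ?_⟩
  have e : Y ^ 4 / (((2 * L + 1 : ℕ) : ℝ) ^ 3 * ((2 * M + 1 : ℕ) : ℝ) ^ 3 * (L : ℝ) ^ 3 *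
      (M : ℝ) ^ 3) = Y ^ 4 / (#K : ℝ) ^ 3 / ((L : ℝ) ^ 2 * (M : ℝ) ^ 2) / #P := by
    rw [hcardK, hcardP]
    ring
  rw [e]
  refine hgq.trans (le_of_eq ?_)
  simp only [hg, hF]

end Summit.Parity.GeneralizedHardyLittlewood.GreenTaoLevelTwoMNTwoTypeIISecondCS
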